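import Mathlib
import HarnessLib.Audit
import Summits.PneNP.PneNP.Theorems.PstarChordReadGates

/-!
# Two simple-gated slice-generic chords kill a terminal core — all switch types (ROUND-24, O1 at exact tightness; memo §6.10 (b)–(d) assembled)

FRONTIER range-avoidance ladder, rung F-N3, ROUND 24 (cell `pnp-ideate`, prover-2 memo `g19/O1-CHORD-READ.md` §6.4–§6.11; referee SCORE 223 (Findings
A–C are hypotheses / do not arise here); typed target `PstarCoreBoundTargets.TerminalPeelable` (p646951); restricted-model proof complexity — nothing
here bears on `P` versus `NP`).

THE CAPSTONE of the chord-read programme for the cheapest gated menu.  By `PstarChordReadLemma` + `PstarChordReadFresh`, in a terminal configuration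
every slice-generic chord is read through a gate on a private whose partner is an outside SWITCH; the simplest such reading is a `SimpleGate`
(`PstarChordReadGates`: one gate `g = (v, z)` on a private `v` of `c`, `z` outside the core and in no other monomial, no other monomial on the AND
pair of `c`; `z` may sit in the linear parts).  Its TYPE is `λ = ([g ∈ G₁], [g ∈ G₂]) ≠ 0`, `e = ([z ∈ C₁], [z ∈ C₂])`; flipping `z` moves `Γ_k` by
`e_k ⊕ (λ_k ∧ x_v)`.

* `exists_xor_not_mem_of_simpleOverlap` — SCORE 223 Finding A never bites: under `SimpleOverlap` two distinct outputs are never parallel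
  (and loops are excluded by purity), so the non-parallelism hypothesis `hv` of `PstarChordReadSwitch` / `PstarChordReadGates` is automatic;
* `false_of_two_simpleGates` — a terminal core has NO two distinct slice-generic chords `cᵢ, cⱼ` each read through a simple gate.
  PROOF.  RANK ONE (`false_of_independent_switches` at a double-slice point, `exists_two_slices`) unless the `2 × 2` determinant of the two move
  vectors vanishes for all four values of `(x_{vᵢ}, x_{vⱼ})`; the finite lemma `types_of_det_zero` then forces a UNIFORM type: I (`λ = (1,0)`, `z`'s
  invisible to `Γ₂`) → `false_of_typeI`; II → `false_of_typeII`; III (`λ = (1,1)`, `e ∈ {0, (1,1)}`) → `false_of_typeIII`.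

With the census facts for the 1800 tight `k = 12` O1 structures (six chords each; at least five slice-generic in class LIN for every `y`,
kit j314774) this closes, in the kernel modulo `SliceGeneric`, every reading in which two generic
chords are simple-gated; the remaining menus (several gates per private, partners shared with `(σ, z)` / `(z, z′)` gates) are the declared residual.
-/

set_option linter.dupNamespace false -- `Summit.PneNP.PneNP.…`: summit = sub-problem name (D-0017 single-conjunct layout)

open Finset Literature.Computability.Complexity
open scoped symmDiff
open Summit.PneNP.PneNP.Theorems.PstarTyped (Typed)
open Summit.PneNP.PneNP.Theorems.PstarSALevel (varSet bdry BoundaryExpanding SimpleOverlap)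
open Summit.PneNP.PneNP.Theorems.PstarCentreFree (vars_mem_varSet)
open Summit.PneNP.PneNP.Theorems.PstarGapOneAll (gval)
open Summit.PneNP.PneNP.Theorems.PstarChordRepair (IsChord)
open Summit.PneNP.PneNP.Theorems.PstarCoreBoundTargets (Terminal)
open Summit.PneNP.PneNP.Theorems.PstarChordReadLemma (SliceGeneric)
open Summit.PneNP.PneNP.Theorems.PstarChordReadSwitch (false_of_typeI false_of_typeII false_of_typeIII false_of_independent_switches)
open Summit.PneNP.PneNP.Theorems.PstarChordReadGates

namespace Summit.PneNP.PneNP.Theorems.PstarChordReadTwoGates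

variable {n m : ℕ}

/-- `G₁ ∆ G₂ ⊆ G₁ ∪ G₂`. -/
private theorem symmDiff_subset_union' (G₁ G₂ : Finset (Fin m)) : G₁ ∆ G₂ ⊆ G₁ ∪ G₂ := fun g hg => by
  rcases Finset.mem_symmDiff.1 hg with ⟨h, -⟩ | ⟨h, -⟩
  · exact mem_union_left _ h
  · exact mem_union_right _ h

/-- **The finite heart of RANK ONE ⟹ UNIFORM TYPE.**  Two gates of types `λᵢ, λⱼ ≠ 0` with linear bits `eᵢ, eⱼ` whose `2 × 2` move determinant
vanishes at all four values of the gated privates have the same type `λ`, with `e ∈ {0, λ}`: type I, II or III. -/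
private theorem types_of_det_zero (e₁ᵢ e₂ᵢ l₁ᵢ l₂ᵢ e₁ⱼ e₂ⱼ l₁ⱼ l₂ⱼ : Bool)
    (h : ((l₁ᵢ || l₂ᵢ) && (l₁ⱼ || l₂ⱼ)) = true ∧
      ((xor e₁ᵢ (l₁ᵢ && false)) && (xor e₂ⱼ (l₂ⱼ && false))) = ((xor e₁ⱼ (l₁ⱼ && false)) && (xor e₂ᵢ (l₂ᵢ && false))) ∧
      ((xor e₁ᵢ (l₁ᵢ && false)) && (xor e₂ⱼ (l₂ⱼ && true))) = ((xor e₁ⱼ (l₁ⱼ && true)) && (xor e₂ᵢ (l₂ᵢ && false))) ∧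
      ((xor e₁ᵢ (l₁ᵢ && true)) && (xor e₂ⱼ (l₂ⱼ && false))) = ((xor e₁ⱼ (l₁ⱼ && false)) && (xor e₂ᵢ (l₂ᵢ && true))) ∧
      ((xor e₁ᵢ (l₁ᵢ && true)) && (xor e₂ⱼ (l₂ⱼ && true))) = ((xor e₁ⱼ (l₁ⱼ && true)) && (xor e₂ᵢ (l₂ᵢ && true)))) :
    (l₁ᵢ = true ∧ l₂ᵢ = false ∧ l₁ⱼ = true ∧ l₂ⱼ = false ∧ e₂ᵢ = false ∧ e₂ⱼ = false) ∨
    (l₁ᵢ = false ∧ l₂ᵢ = true ∧ l₁ⱼ = false ∧ l₂ⱼ = true ∧ e₁ᵢ = false ∧ e₁ⱼ = false) ∨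
    (l₁ᵢ = true ∧ l₂ᵢ = true ∧ l₁ⱼ = true ∧ l₂ⱼ = true ∧ e₂ᵢ = e₁ᵢ ∧ e₂ⱼ = e₁ⱼ) := by
  obtain ⟨hl, h00, h01, h10, h11⟩ := h
  cases l₁ᵢ <;> cases l₂ᵢ <;> cases l₁ⱼ <;> cases l₂ⱼ <;> cases e₁ᵢ <;> cases e₂ᵢ <;> cases e₁ⱼ <;> cases e₂ⱼ <;> simp_all

/-- **Finding A never bites under simple overlaps**: two distinct outputs share at most one variable, so they are not parallel — some XOR variable
of `cᵢ` is not a variable of `cⱼ`. -/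
theorem exists_xor_not_mem_of_simpleOverlap {I : LocalMap 4 n m} (hI : I.IsPure xorAndPred) (hS : SimpleOverlap I) {cᵢ cⱼ : Fin m}
    (hne : cᵢ ≠ cⱼ) : ∃ s : Fin 4, s.val < 2 ∧ I.vars cᵢ s ∉ varSet I cⱼ := by
  classical
  by_contra h
  push Not at h
  have h0 := h 0 (by decide)
  have h1 := h 1 (by decide)
  have h01 : I.vars cᵢ 0 ≠ I.vars cᵢ 1 := fun e => absurd (hI.2 cᵢ e) (by decide)
  have hsub : ({I.vars cᵢ 0, I.vars cᵢ 1} : Finset (Fin n)) ⊆ varSet I cᵢ ∩ varSet I cⱼ := by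
    intro u hu
    rcases mem_insert.1 hu with e | e
    · exact e ▸ mem_inter.2 ⟨vars_mem_varSet I cᵢ 0, h0⟩
    · exact (mem_singleton.1 e) ▸ mem_inter.2 ⟨vars_mem_varSet I cᵢ 1, h1⟩
  have h2 : ({I.vars cᵢ 0, I.vars cᵢ 1} : Finset (Fin n)).card = 2 := card_pair h01
  have := (card_le_card hsub).trans (hS cᵢ cⱼ hne)
  omega

section Main

variable {I : LocalMap 4 n m} {r : ℕ} {y : Fin m → Bool} {J₀ : Finset (Fin m)} {w₁ w₂ : Finset (Fin n) × Finset (Fin m) × Bool}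
  {cᵢ cⱼ gᵢ gⱼ : Fin m} {vᵢ zᵢ vⱼ zⱼ : Fin n}

/-- A slice of `c` on which the gated private `v` has the prescribed value. -/
private theorem exists_slice {c g : Fin m} {v z : Fin n} (h : SimpleGate I J₀ w₁ w₂ c g v z) (s : Bool) :
    ∃ π κ : Bool, ∀ x : Fin n → Bool, x (I.vars c 2) = π → x (I.vars c 3) = κ → x v = s := by
  rcases h.2.1 with e | e
  · exact ⟨s, false, fun x hp _ => by rw [e]; exact hp⟩
  · exact ⟨false, s, fun x _ hq => by rw [e]; exact hq⟩

/-- **CAPSTONE.  A terminal core has no two distinct slice-generic chords each read through a simple switch gate.** -/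
theorem false_of_two_simpleGates (hI : I.IsPure xorAndPred) (hT : Typed I) (hS : SimpleOverlap I) (hB : BoundaryExpanding r I)
    (ht : Terminal I r y J₀ w₁ w₂) (hcᵢ : cᵢ ∈ J₀) (hcⱼ : cⱼ ∈ J₀) (hne : cᵢ ≠ cⱼ) (hchᵢ : IsChord I J₀ cᵢ) (hchⱼ : IsChord I J₀ cⱼ)
    (hGᵢ : SimpleGate I J₀ w₁ w₂ cᵢ gᵢ vᵢ zᵢ) (hGⱼ : SimpleGate I J₀ w₁ w₂ cⱼ gⱼ vⱼ zⱼ)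
    (hgenᵢ : SliceGeneric I y J₀ cᵢ (w₁.2.1 ∪ w₂.2.1)) (hgenⱼ : SliceGeneric I y J₀ cⱼ (w₁.2.1 ∪ w₂.2.1)) : False := by
  classical
  have hv := exists_xor_not_mem_of_simpleOverlap hI hS hne
  -- bookkeeping: the two gates and the two switches are distinct
  have hvᵢ : vᵢ ∈ varSet I cᵢ := by rcases hGᵢ.2.1 with e | e <;> rw [e] <;> exact vars_mem_varSet I cᵢ _
  have hvⱼ : vⱼ ∈ varSet I cⱼ := by rcases hGⱼ.2.1 with e | e <;> rw [e] <;> exact vars_mem_varSet I cⱼ _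
  have hvz : vⱼ ≠ zᵢ := fun e => hGᵢ.2.2.2.1 cⱼ hcⱼ (e ▸ hvⱼ)
  have hzv : vᵢ ≠ zⱼ := fun e => hGⱼ.2.2.2.1 cᵢ hcᵢ (e ▸ hvᵢ)
  have hvv : vᵢ ≠ vⱼ := by
    intro e
    have hpriv : vᵢ ∈ bdry I J₀ := by rcases hGᵢ.2.1 with h | h <;> rw [h]; exacts [hchᵢ.1, hchᵢ.2]
    exact PstarGapPeeling.not_mem_varSet_of_private I hcᵢ hcⱼ hne.symm hpriv hvᵢ (e ▸ hvⱼ)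
  have hgg : gⱼ ≠ gᵢ := by
    intro e
    have hj := hGⱼ.2.2.1
    rw [e] at hj
    rcases hGᵢ.2.2.1 with ⟨h2, h3⟩ | ⟨h2, h3⟩ <;> rcases hj with ⟨k2, k3⟩ | ⟨k2, k3⟩
    · exact hvv (h2.symm.trans k2)
    · exact hzv (h2.symm.trans k2)
    · exact hvz (k2.symm.trans h2)
    · exact hvv (h3.symm.trans k3)
  have hzz : zᵢ ≠ zⱼ := by
    intro e
    have h := hGᵢ.2.2.2.2.1 gⱼ hGⱼ.1 hgg
    rcases hGⱼ.2.2.1 with ⟨-, k3⟩ | ⟨k2, -⟩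
    · exact h.2 (k3.trans e.symm)
    · exact h.1 (k2.trans e.symm)
  -- a solution with prescribed gated privates
  have hsol : ∀ s t : Bool, ∃ x : Fin n → Bool, (∀ j ∈ J₀, I.eval x j = y j) ∧ x vᵢ = s ∧ x vⱼ = t := by
    intro s t
    obtain ⟨πᵢ, κᵢ, hπᵢ⟩ := exists_slice hGᵢ s
    obtain ⟨πⱼ, κⱼ, hπⱼ⟩ := exists_slice hGⱼ t
    obtain ⟨x, hx, h2, h3, h2', h3'⟩ := exists_two_slices hI hcᵢ hcⱼ hne hchᵢ hchⱼ hv hgenᵢ πᵢ κᵢ πⱼ κⱼ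
    exact ⟨x, hx, hπᵢ x h2 h3, hπⱼ x h2' h3'⟩
  have hlᵢ : (decide (gᵢ ∈ w₁.2.1) || decide (gᵢ ∈ w₂.2.1)) = true := by
    rcases mem_union.1 hGᵢ.1 with h | h <;> simp [h]
  have hlⱼ : (decide (gⱼ ∈ w₁.2.1) || decide (gⱼ ∈ w₂.2.1)) = true := by
    rcases mem_union.1 hGⱼ.1 with h | h <;> simp [h]
  -- RANK ONE unless the determinant vanishes at all four private values
  by_cases H : ∃ s t : Bool,
      ((xor (decide (zᵢ ∈ w₁.1)) (decide (gᵢ ∈ w₁.2.1) && s)) && (xor (decide (zⱼ ∈ w₂.1)) (decide (gⱼ ∈ w₂.2.1) && t))) ≠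
      ((xor (decide (zⱼ ∈ w₁.1)) (decide (gⱼ ∈ w₁.2.1) && t)) && (xor (decide (zᵢ ∈ w₂.1)) (decide (gᵢ ∈ w₂.2.1) && s)))
  · obtain ⟨s, t, hst⟩ := H
    obtain ⟨x, hx, hxs, hxt⟩ := hsol s t
    have f₁ := hGᵢ.flip₁ hI hcᵢ x
    have f₂ := hGᵢ.flip₂ hI hcᵢ x
    have f₁' := hGⱼ.flip₁ hI hcⱼ x
    have f₂' := hGⱼ.flip₂ hI hcⱼ x
    have d₁ := hGⱼ.flip₁ hI hcⱼ (Function.update x zᵢ (!x zᵢ))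
    have d₂ := hGⱼ.flip₂ hI hcⱼ (Function.update x zᵢ (!x zᵢ))
    rw [hxs] at f₁ f₂
    rw [hxt] at f₁' f₂'
    rw [Function.update_of_ne hzz.symm, Function.update_of_ne hvz, f₁, hxt] at d₁
    rw [Function.update_of_ne hzz.symm, Function.update_of_ne hvz, f₂, hxt] at d₂
    exact false_of_independent_switches ht hGᵢ.2.2.2.1 hGⱼ.2.2.2.1 hx _ _ _ _ f₁ f₂ f₁' f₂' d₁ d₂ hst
  · push Not at H
    rcases types_of_det_zero _ _ _ _ _ _ _ _ ⟨by rw [hlᵢ, hlⱼ]; rfl, H false false, H false true, H true false, H true true⟩ with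
      ⟨k₁ᵢ, k₂ᵢ, k₁ⱼ, k₂ⱼ, kzᵢ, kzⱼ⟩ | ⟨k₁ᵢ, k₂ᵢ, k₁ⱼ, k₂ⱼ, kzᵢ, kzⱼ⟩ | ⟨k₁ᵢ, k₂ᵢ, k₁ⱼ, k₂ⱼ, kzᵢ, kzⱼ⟩
    · -- TYPE I: both gates in `Γ₁` only, switches invisible to `Γ₂`
      have hgᵢ₂ : gᵢ ∉ w₂.2.1 := of_decide_eq_false k₂ᵢ
      have hgⱼ₂ : gⱼ ∉ w₂.2.1 := of_decide_eq_false k₂ⱼ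
      obtain ⟨πᵢ, κᵢ, hπᵢ⟩ := exists_slice hGᵢ (!decide (zᵢ ∈ w₁.1))
      obtain ⟨πⱼ, κⱼ, hπⱼ⟩ := exists_slice hGⱼ (!decide (zⱼ ∈ w₁.1))
      refine false_of_typeI hI hT hS hB ht hcᵢ hcⱼ hne hchᵢ hchⱼ hv (hGᵢ.mono_of_not_mem subset_union_right hgᵢ₂)
        (hGⱼ.mono_of_not_mem subset_union_right hgⱼ₂) (sliceGeneric_mono subset_union_right hgenᵢ)
        (sliceGeneric_mono subset_union_right hgenⱼ) hGᵢ.2.2.2.1 (of_decide_eq_false kzᵢ)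
        (hGᵢ.invisible_of_not_mem subset_union_right hgᵢ₂) hGⱼ.2.2.2.1 (of_decide_eq_false kzⱼ)
        (hGⱼ.invisible_of_not_mem subset_union_right hgⱼ₂) πᵢ κᵢ πⱼ κⱼ (fun x hx hp hq => ?_) (fun x hx hp hq => ?_)
      · rw [hGᵢ.flip₁ hI hcᵢ x, hπᵢ x hp hq, k₁ᵢ]
        cases gval I w₁.1 w₁.2.1 x <;> cases decide (zᵢ ∈ w₁.1) <;> decide
      · rw [hGⱼ.flip₁ hI hcⱼ x, hπⱼ x hp hq, k₁ⱼ]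
        cases gval I w₁.1 w₁.2.1 x <;> cases decide (zⱼ ∈ w₁.1) <;> decide
    · -- TYPE II: both gates in `Γ₂` only, switches invisible to `Γ₁`
      have hgᵢ₁ : gᵢ ∉ w₁.2.1 := of_decide_eq_false k₁ᵢ
      have hgⱼ₁ : gⱼ ∉ w₁.2.1 := of_decide_eq_false k₁ⱼ
      obtain ⟨πᵢ, κᵢ, hπᵢ⟩ := exists_slice hGᵢ (!decide (zᵢ ∈ w₂.1))
      obtain ⟨πⱼ, κⱼ, hπⱼ⟩ := exists_slice hGⱼ (!decide (zⱼ ∈ w₂.1))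
      refine false_of_typeII hI hT hS hB ht hcᵢ hcⱼ hne hchᵢ hchⱼ hv (hGᵢ.mono_of_not_mem subset_union_left hgᵢ₁)
        (hGⱼ.mono_of_not_mem subset_union_left hgⱼ₁) (sliceGeneric_mono subset_union_left hgenᵢ)
        (sliceGeneric_mono subset_union_left hgenⱼ) hGᵢ.2.2.2.1 (of_decide_eq_false kzᵢ)
        (hGᵢ.invisible_of_not_mem subset_union_left hgᵢ₁) hGⱼ.2.2.2.1 (of_decide_eq_false kzⱼ)
        (hGⱼ.invisible_of_not_mem subset_union_left hgⱼ₁) πᵢ κᵢ πⱼ κⱼ (fun x hx hp hq => ?_) (fun x hx hp hq => ?_)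
      · rw [hGᵢ.flip₂ hI hcᵢ x, hπᵢ x hp hq, k₂ᵢ]
        cases gval I w₂.1 w₂.2.1 x <;> cases decide (zᵢ ∈ w₂.1) <;> decide
      · rw [hGⱼ.flip₂ hI hcⱼ x, hπⱼ x hp hq, k₂ⱼ]
        cases gval I w₂.1 w₂.2.1 x <;> cases decide (zⱼ ∈ w₂.1) <;> decide
    · -- TYPE III: both gates in both readers (they cancel in the sum reader), switches move both readers alike
      have hgᵢ : gᵢ ∉ w₁.2.1 ∆ w₂.2.1 := fun h => by
        rcases Finset.mem_symmDiff.1 h with ⟨-, h2⟩ | ⟨-, h1⟩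
        · exact h2 (of_decide_eq_true k₂ᵢ)
        · exact h1 (of_decide_eq_true k₁ᵢ)
      have hgⱼ : gⱼ ∉ w₁.2.1 ∆ w₂.2.1 := fun h => by
        rcases Finset.mem_symmDiff.1 h with ⟨-, h2⟩ | ⟨-, h1⟩
        · exact h2 (of_decide_eq_true k₂ⱼ)
        · exact h1 (of_decide_eq_true k₁ⱼ)
      obtain ⟨πᵢ, κᵢ, hπᵢ⟩ := exists_slice hGᵢ (!decide (zᵢ ∈ w₁.1))
      obtain ⟨πⱼ, κⱼ, hπⱼ⟩ := exists_slice hGⱼ (!decide (zⱼ ∈ w₁.1))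
      refine false_of_typeIII hI hT hS hB ht hcᵢ hcⱼ hne hchᵢ hchⱼ hv (hGᵢ.mono_of_not_mem (symmDiff_subset_union' _ _) hgᵢ)
        (hGⱼ.mono_of_not_mem (symmDiff_subset_union' _ _) hgⱼ) (sliceGeneric_mono (symmDiff_subset_union' _ _) hgenᵢ)
        (sliceGeneric_mono (symmDiff_subset_union' _ _) hgenⱼ) hGᵢ.2.2.2.1 hGⱼ.2.2.2.1 πᵢ κᵢ πⱼ κⱼ
        (fun x hx hp hq => ⟨?_, ?_⟩) (fun x hx hp hq => ⟨?_, ?_⟩)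
      · rw [hGᵢ.flip₁ hI hcᵢ x, hπᵢ x hp hq, k₁ᵢ]
        cases gval I w₁.1 w₁.2.1 x <;> cases decide (zᵢ ∈ w₁.1) <;> decide
      · rw [hGᵢ.flip₂ hI hcᵢ x, hπᵢ x hp hq, k₂ᵢ, kzᵢ]
        cases gval I w₂.1 w₂.2.1 x <;> cases decide (zᵢ ∈ w₁.1) <;> decide
      · rw [hGⱼ.flip₁ hI hcⱼ x, hπⱼ x hp hq, k₁ⱼ]
        cases gval I w₁.1 w₁.2.1 x <;> cases decide (zⱼ ∈ w₁.1) <;> decide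
      · rw [hGⱼ.flip₂ hI hcⱼ x, hπⱼ x hp hq, k₂ⱼ, kzⱼ]
        cases gval I w₂.1 w₂.2.1 x <;> cases decide (zⱼ ∈ w₁.1) <;> decide

end Main

end Summit.PneNP.PneNP.Theorems.PstarChordReadTwoGates
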